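import Summits.QuantumFields.QCD.Theses.GaussianLinkFrames
import Summits.QuantumFields.QCD.Theorems.GaussianLinkFramesFrameAPrioriBoundLineDefs
import Literature.MathematicalPhysics.QuantumLattice.GrassmannIntegralProofs
import Literature.MathematicalPhysics.QuantumLattice.SpectralLocalizer
import Summits.QuantumFields.QCD.Theorems.FrameAPrioriBound.Negative.SlabFlatBand

/-!
# Disproof of `FrameAPrioriBound` (stmt-QuantumFields-17374) — findings

Work file of the standing disprover (refuter `cdisprove-stmt-QuantumFields-17374`, cycle 1,
2026-08-17) on the crux `Summit.QuantumFields.QCD.Theses.GaussianLinkFrames.FrameAPrioriBound`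
(route `GaussianLinkFrames`, sub-problem `QCD`) and on the picked line `cube-cofactor`
(its only open stub `CubeCofactor.stub_cubeMeanSquareDomination`, "(MS)").

**Verdict of this cycle: NO KILL.**  The crux survives every cheap attack; (MS) survives every attack
short of an `x`-visible dark datum of the `Q₂` pencil, which I could not construct.  Index:

* §A  Typing audit — no junk: `wilsonDirac U m₀ 1` genuine, `H = γ₅ D_W` Hermitian
  (`wilsonDirac_gammaFive_hermitian`), so `‖R‖ ≤ 1/|Im z|`, integrand bounded continuous, denominator
  `∫ wt > 0`, `(1+B)^p` is an `rpow` with base `≥ 1`; quantifier order matches the thesis text.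
* §B  The large-`B` regime cannot refute a `(1+B)^p` allowance (docstring `largeB_cannot_win`):
  every tilt-driven concentration (pinning near a flat / Landau / coset background, large deviations)
  resolves spectral scale `η` only at cost `B ≳ η⁻²`, so the fractional moment gains at most
  `B^{s/2}`–`B^{s}`, absorbed by `p ≥ s`.
* §C  Bounded-`B` (pure Haar) refutation via a Dyson/Gade density-of-states singularity needs a
  chiral (sublattice) symmetry; the on-site term `(m₀+4)γ₅`, `m₀+4 ∈ [2,6]`, has none, and the
  Wilson term breaks the candidate `Γ = γ_μ ⊗ ε`.  No mechanism (docstring `noChiralSymmetry_note`).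
* §D  No `W`-independent compactly supported eigenvector exists for ANY gauge field (corner argument:
  two anticommuting `γ`'s) — `noBlindSpinor` below is the algebraic core; only codimension-1
  wrapping slabs of thickness 2 survive, and only at `m₀ = -1`, `E = ±1` (§E).
* §E  The flat edge.  At `m₀ = -1` the free dispersion obeys `E² − 1 = (Σd)² − Σd²  (d_μ = 1 − cos p_μ)`
  (`flatEdge_dispersion`, `flatEdge_nonneg`): `|E| ≥ 1` with equality exactly on the four momentum
  axes.  Realisation on the torus: for `L ≥ 7`, pure-gauge exterior links on the thickness-2 slab
  `{v_μ ∈ {x_μ+3, x_μ+4}}` adjacent to the face of `Q₂(x)` carry `6 + 6` EXACT eigenvectors of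
  `H(refit W)` at `E = ±1` for EVERY fibre configuration `W` (chiral boundary data `(1∓γ_μ)ψ = 0`
  make the port hopping vanish identically in `W`): `slabCore_*` below is the two-layer algebra; the
  torus-level statement `det (hz (refit (touches 0 0) U W) (-1) E) = 0 ∀ W` (`E = ±1`, `U` trivial on
  the slab) is LANDED: `Theorems/FrameAPrioriBound/Negative/SlabFlatBand.lean` (p173367, ACCEPTED), theorems
  `Negative.det_hz_refit_eq_zero`, `Negative.ms_rhs_eq_zero` (`E_W |det|² = 0` there), re-exported below as
  `slabFlatBand_det_eq_zero`, `slabFlatBand_ms_rhs_eq_zero`.  Consequences: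
  (i) the (MS) edge case `det ≡ 0 on the fibre` is REALISED inside the parameter window
  (`m₀ = -1 ∈ [-2,2]`, `z = ±1`, `|z| = 1`), with corank `≥ 6` per flat slab (up to 8 slabs for `L ≥ 9`),
  hence `adj ≡ 0` there and (MS) reads `0 ≤ 0` — not violated; (ii) `z = ±1` at `m₀ = -1` is ALSO the
  band edge of the `W`-independent free exterior continuum (`flatEdge_nonneg`): the lead's "untreated
  non-isolated case" is realised exactly here; (iii) approach heuristics (`z → ±1`, near-axis slab
  states of transverse momentum `q`): leakage into the cube `∼ q`, `W`-oscillation of the level shift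
  `∼ q²`, ratio `|leak|⁴/osc² = O(1)` — consistent with (MS), no blow-up found.
* §F  Line `cube-cofactor`: (MS) fails iff an `x`-VISIBLE dark datum exists (det ≡ 0 in `W`, generic
  corank 1, kernel line visible at `x`); every mechanism I know produces invisible or high-corank data
  (§E; exterior flat bands with `k > #port dims` give corank `≥ k − rank B ≥ 2` and kernels `Φc` with
  `Bc = 0`, i.e. invisible, unless `A(W)⁻¹|_{range B(W)}` is degenerate for all `W`).  Non-convex
  unions `Q₂(x) ∪ Q₂(y)` (e.g. `y = x + (3,3,0,0)`) have DOUBLY-ATTACHED exterior sites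
  (`s = x + (3,0,0,0)`: ports in directions 1 and 2), where the chiral boundary condition degenerates
  to `ψ_s = 0` (`noBlindSpinor`) — harmless for (MS), but the "one port per boundary site" bookkeeping of
  the compactification must allow 12-dimensional two-link ports there.
* §G  Hypothesis mutation of the crux (docstrings `mutation_*`): `0 < s` → statement TRIVIAL without
  it (`s = 0`); `Im z ≠ 0` → not load-bearing (real `z` follows by Fatou); `s < 1` → `s = 1` false
  (log-divergent first moment) but only via random-matrix lower bounds, not Lean-closable here;
  `p`-uniformity (`p = 0`) false by Haar small-ball concentration under strong tilts, not closable;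
  un-normalised version (drop `/ ∫ wt`) false but uninformative.  None yields a landable
  `_false_without_` theorem this cycle.

Nothing in this file asserts the crux or a stub positively.  No sorries (the §E torus statement is
imported from the landed Negative/ file; §F's criterion implication is proved).
-/

noncomputable section

namespace Summit.QuantumFields.QCD.Cruxes.FrameAPrioriBound.Disproof

open scoped BigOperators Matrix
open MeasureTheory Filter Literature.MathematicalPhysics.QuantumFieldTheory
  Literature.MathematicalPhysics.QuantumLattice Literature.Probability.LatticeModels
open Summit.QuantumFields.QCD.Cruxes.FrameAPrioriBound.CubeCofactor

/-! ## §D  No blind spinor (corner lemma core) -/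

/-- **No blind spinor.**  Two distinct Euclidean gamma matrices have no common eigenvector with
non-zero eigenvalues: `γ_μ v = σ v`, `γ_ν v = τ v`, `μ ≠ ν`, `σ τ ≠ 0` force `v = 0`
(anticommutation: `0 = {γ_μ,γ_ν} v = 2στ v`).  Colour-extended componentwise, this is why an exterior
site attached to the re-sampled region through links in two different DIRECTIONS carries no
`W`-robust boundary datum, why no compactly supported `W`-independent eigenvector exists (take a
support site extreme in `x₁`, then in `x₂`), and why the full Dirichlet cavity kills every cube site
with two outward axes. [folklore] -/
theorem noBlindSpinor {μ ν : Fin 4} (hμν : μ ≠ ν) {σ τ : ℂ} (hσ : σ ≠ 0) (hτ : τ ≠ 0)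
    (v : Fin 4 → ℂ) (hμ : euclideanGamma μ *ᵥ v = σ • v) (hν : euclideanGamma ν *ᵥ v = τ • v) :
    v = 0 := by
  have hanti := euclideanGamma_anticomm_holds μ ν
  rw [if_neg hμν] at hanti
  have h1 : (euclideanGamma μ * euclideanGamma ν + euclideanGamma ν * euclideanGamma μ) *ᵥ v =
      (2 * (σ * τ)) • v := by
    rw [Matrix.add_mulVec, ← Matrix.mulVec_mulVec, ← Matrix.mulVec_mulVec, hν, hμ,
      Matrix.mulVec_smul, Matrix.mulVec_smul, hμ, hν, smul_smul, smul_smul, ← add_smul]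
    congr 1
    ring
  rw [hanti, Matrix.zero_mulVec] at h1
  have h2 : (2 * (σ * τ)) ≠ 0 := mul_ne_zero two_ne_zero (mul_ne_zero hσ hτ)
  exact ((smul_eq_zero.mp h1.symm).resolve_left h2)

/-! ## §E  The flat edge at `m₀ = -1` and the slab flat band -/

/-- **Flat-edge identity.**  For the free Hermitian Wilson–Dirac kernel `H = γ₅ D_W(1; m₀, 1)` the
momentum-space square is `H(p)² = M(p)² + Σ_μ sin² p_μ` with `M(p) = m₀ + Σ_μ (1 − cos p_μ)`.
Writing `d_μ = 1 − cos p_μ ∈ [0,2]` (so `sin² p_μ = 1 − (1 − d_μ)² = d_μ(2 − d_μ)`), at `m₀ = -1`: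
`E² − 1 = (Σ_μ d_μ)² − Σ_μ d_μ² = 2 Σ_{μ<ν} d_μ d_ν`.  Pure algebra, recorded as the identity below.
[folklore] -/
theorem flatEdge_dispersion (d : Fin 4 → ℝ) :
    ((-1 + ∑ μ, d μ) ^ 2 + ∑ μ, d μ * (2 - d μ)) - 1 = (∑ μ, d μ) ^ 2 - ∑ μ, d μ ^ 2 := by
  simp only [Fin.sum_univ_four]
  ring

/-- **Flat edge: `|E| ≥ 1` at `m₀ = -1`, with equality exactly on the momentum axes.**  For
`d_μ ≥ 0` the right-hand side of `flatEdge_dispersion` is `2 Σ_{μ<ν} d_μ d_ν ≥ 0`, and it vanishes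
iff at most one `d_μ` is non-zero (momentum on a coordinate axis), where `E = ±1` identically in the
remaining momentum: a degenerate ("flat") band edge of the `W`-independent free exterior continuum,
inside the crux's window (`m₀ = -1`, `|z| = 1`). [folklore] -/
theorem flatEdge_nonneg (d : Fin 4 → ℝ) (hd : ∀ μ, 0 ≤ d μ) :
    0 ≤ (∑ μ, d μ) ^ 2 - ∑ μ, d μ ^ 2 := by
  simp only [Fin.sum_univ_four]
  have h0 := hd 0; have h1 := hd 1; have h2 := hd 2; have h3 := hd 3
  nlinarith [mul_nonneg h0 h1, mul_nonneg h0 h2, mul_nonneg h0 h3, mul_nonneg h1 h2,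
    mul_nonneg h1 h3, mul_nonneg h2 h3]

/-- On an axis (`d_ν = 0` for `ν ≠ μ`) the flat-edge defect vanishes: `E² = 1` for every `d_μ`.
[folklore] -/
theorem flatEdge_axis (μ : Fin 4) (t : ℝ) :
    (∑ ν, (Pi.single μ t : Fin 4 → ℝ) ν) ^ 2 - ∑ ν, (Pi.single μ t : Fin 4 → ℝ) ν ^ 2 = 0 := by
  fin_cases μ <;> simp [Fin.sum_univ_four]

/-- **Slab partner chirality.**  If `γ_μ s = s` then `t := γ₅ s` satisfies `γ_μ t = -t`
(`γ₅ γ_μ = -γ_μ γ₅`).  [folklore] -/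
theorem slabCore_partner {μ : Fin 4} {s : Fin 4 → ℂ} (hs : euclideanGamma μ *ᵥ s = s) :
    euclideanGamma μ *ᵥ (gammaFive *ᵥ s) = -(gammaFive *ᵥ s) := by
  have hcomm : euclideanGamma μ * gammaFive = -(gammaFive * euclideanGamma μ) := by
    rw [gammaFive_mul_euclideanGamma, neg_neg]
  rw [Matrix.mulVec_mulVec, hcomm, Matrix.neg_mulVec, ← Matrix.mulVec_mulVec, hs]

/-- **Slab flat band, two-layer algebra (`E = ±1`).**  Let `γ_μ s = s` and put `β := -E • γ₅ s` on
the outer layer, `α := s` on the inner layer of a thickness-2 slab orthogonal to `μ`, constant in the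
transverse directions, pure-gauge links on the slab, `m₀ = -1`, `r = 1` (so the on-site term `m₀+4 = 3`
is cancelled exactly by the three transverse Wilson hops at transverse momentum `0`).  The remaining
two-layer equations of `H ψ = E ψ`, `H = γ₅ D_W`, are
`-½ γ₅ (1 − γ_μ) β = E α` (inner row) and `-½ γ₅ (1 + γ_μ) α = E β` (outer row); the rows just
outside the slab vanish because `(1 − γ_μ) α = 0` and `(1 + γ_μ) β = 0` — conditions that are blind
to the (random, re-sampled) port link multiplying them.  This theorem is the inner-row identity.
[folklore] -/
theorem slabCore_inner {μ : Fin 4} {s : Fin 4 → ℂ} (hs : euclideanGamma μ *ᵥ s = s) (E : ℂ) :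
    (-(1 / 2 : ℂ)) • (gammaFive *ᵥ ((1 - euclideanGamma μ) *ᵥ ((-E) • (gammaFive *ᵥ s)))) =
      E • s := by
  have hpart := slabCore_partner hs
  have h55 : gammaFive *ᵥ (gammaFive *ᵥ s) = s := by
    rw [Matrix.mulVec_mulVec, gammaFive_mul_self, Matrix.one_mulVec]
  rw [Matrix.mulVec_smul, Matrix.sub_mulVec, Matrix.one_mulVec, hpart, sub_neg_eq_add,
    ← two_smul ℂ (gammaFive *ᵥ s), smul_smul, Matrix.mulVec_smul, h55, smul_smul]
  congr 1
  ring
  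
/-- Outer-row identity of the slab flat band (see `slabCore_inner`). [folklore] -/
theorem slabCore_outer {μ : Fin 4} {s : Fin 4 → ℂ} (hs : euclideanGamma μ *ᵥ s = s) (E : ℂ)
    (hE : E * E = 1) :
    (-(1 / 2 : ℂ)) • (gammaFive *ᵥ ((1 + euclideanGamma μ) *ᵥ s)) = E • ((-E) • (gammaFive *ᵥ s)) := by
  rw [Matrix.add_mulVec, Matrix.one_mulVec, hs, ← two_smul ℂ s, Matrix.mulVec_smul, smul_smul,
    smul_smul]
  congr 1
  linear_combination hE

/-- Port blindness of the slab datum: the rows just outside the slab see `(1 − γ_μ) α` and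
`(1 + γ_μ) β`, which vanish — whatever `SU(3)` matrix multiplies the colour index. [folklore] -/
theorem slabCore_ports {μ : Fin 4} {s : Fin 4 → ℂ} (hs : euclideanGamma μ *ᵥ s = s) (E : ℂ) :
    (1 - euclideanGamma μ) *ᵥ s = 0 ∧
      (1 + euclideanGamma μ) *ᵥ ((-E) • (gammaFive *ᵥ s)) = 0 := by
  refine ⟨?_, ?_⟩
  · rw [Matrix.sub_mulVec, Matrix.one_mulVec, hs, sub_self]
  · rw [Matrix.mulVec_smul, Matrix.add_mulVec, Matrix.one_mulVec, slabCore_partner hs,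
      add_neg_cancel, smul_zero]

/-- A concrete `+1` eigenvector of `γ₃ = σˣ ⊗ 1`: `s₊ = (1,0,1,0)`; with its colour copies this gives
the `2 × 3 = 6` slab states per sign of `E` and per flat slab. [folklore] -/
theorem gammaThree_mulVec_splus : euclideanGamma 3 *ᵥ ![1, 0, 1, 0] = ![1, 0, 1, 0] := by
  rw [euclideanGamma_three]
  ext i
  fin_cases i <;> simp [Matrix.mulVec, dotProduct, Fin.sum_univ_four]

/-- **Slab flat band on the torus (realised dark fibre of the `Q₂` pencil)** — LANDED
(`Negative/SlabFlatBand.lean`, p173367).  `L = 7`, `x = y = 0`, `m₀ = -1`, `z = E = ±1`: for every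
background `U` trivial on the slab links and EVERY configuration `W` of the links touching `Q₂(0)`,
`det (H(refit W) − E) = 0` — the `W`-robust eigenvectors are the slab states of `slabCore_*` on the
layers `{v₃ = 3, 4}`, invisible on `Q₂(0)` (ports blind: `(1−γ₃)s₊ = 0`, `(1+γ₃)γ₅s₊ = 0`). -/
theorem slabFlatBand_det_eq_zero (U W : GaugeConfig 4 7 CubeCofactor.SU3)
    (hT : ∀ (v : TorusSite 4 7) (μ : Fin 4), μ ≠ 3 → (v 3 = 3 ∨ v 3 = 4) → U (v, μ) = 1)
    (hF : ∀ v : TorusSite 4 7, v 3 = 3 → U (v, 3) = 1) (E : ℂ) (hE : E = 1 ∨ E = -1) :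
    (hz (refit (touches (0 : TorusSite 4 7) 0) U W) (-1) E).det = 0 :=
  Summit.QuantumFields.QCD.Theorems.FrameAPrioriBound.Negative.det_hz_refit_eq_zero U W hT hF E hE

/-- The special case quoted in §E: trivial background, `z = 1`. -/
theorem slabFlatBand_det_eq_zero_one (W : GaugeConfig 4 7 CubeCofactor.SU3) :
    (hz (refit (touches (0 : TorusSite 4 7) 0) (fun _ => 1) W) (-1) 1).det = 0 :=
  slabFlatBand_det_eq_zero _ W (fun _ _ _ _ => rfl) (fun _ _ => rfl) 1 (Or.inl rfl)

/-- **The RHS of (MS) vanishes on a realisable fibre inside the window** (LANDED, p173367):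
`E_W |det (H(refit W) − E)|² = 0` at `(L, m₀, z, x, y, U) = (7, -1, ±1, 0, 0, 1)`. -/
theorem slabFlatBand_ms_rhs_eq_zero (E : ℂ) (hE : E = 1 ∨ E = -1) :
    ∫ W, ‖(hz (refit (touches (0 : TorusSite 4 7) 0) (fun _ => 1) W) (-1) E).det‖ ^ 2
      ∂(haarPi 7) = 0 :=
  Summit.QuantumFields.QCD.Theorems.FrameAPrioriBound.Negative.ms_rhs_eq_zero E hE

/-! ## §F  Line `cube-cofactor`: what a kill of (MS) must look like -/

/-- (MS) verbatim — the open stub `CubeCofactor.stub_cubeMeanSquareDomination` of the picked line,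
restated as a `Prop` so that negative results can refer to it. -/
def CubeMeanSquareDomination : Prop :=
  ∃ C₂ : ℝ, 0 < C₂ ∧ ∀ (L : ℕ) [NeZero L], 4 ≤ L →
    ∀ (m₀ : ℝ), -2 ≤ m₀ → m₀ ≤ 2 → ∀ (z : ℂ), ‖z‖ ≤ 1 → ∀ (x y : TorusSite 4 L)
    (U : GaugeConfig 4 L CubeCofactor.SU3),
    ∫ W, (∑ a : Fin 3, ∑ i : Fin 4, ∑ b : Fin 3, ∑ j : Fin 4,
        ‖(hz (refit (touches x y) U W) m₀ z).adjugate (x, a, i) (y, b, j)‖) ^ 2 ∂(haarPi L) ≤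
      C₂ * ∫ W, ‖(hz (refit (touches x y) U W) m₀ z).det‖ ^ 2 ∂(haarPi L)

/-- **Visible dark datum** — the only shape of counterexample to (MS) at a point where the right side
can vanish: a background `U`, parameters in the window, and sites `x, y` such that `det ≡ 0` on the
fibre while the `(x,y)` adjugate block is not a.e. zero.  (For `Im z ≠ 0`, or real `z` with
`det ≢ 0`, both sides are positive and only the local order comparison near dark data can break the
uniformity — lead's NOTES §Cofactor domination; my §E(iii) heuristic finds no blow-up at the realised
flat slabs.) -/
def VisibleDarkDatum : Prop :=
  ∃ (L : ℕ) (_ : NeZero L), 4 ≤ L ∧ ∃ (m₀ : ℝ), -2 ≤ m₀ ∧ m₀ ≤ 2 ∧ ∃ (z : ℂ), ‖z‖ ≤ 1 ∧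
    ∃ (x y : TorusSite 4 L) (U : GaugeConfig 4 L CubeCofactor.SU3),
      (∀ W, (hz (refit (touches x y) U W) m₀ z).det = 0) ∧
      0 < ∫ W, (∑ a : Fin 3, ∑ i : Fin 4, ∑ b : Fin 3, ∑ j : Fin 4,
        ‖(hz (refit (touches x y) U W) m₀ z).adjugate (x, a, i) (y, b, j)‖) ^ 2 ∂(haarPi L)

/-- A visible dark datum kills (MS): the right side is `C₂ · 0`, the left side is positive. [folklore] -/
theorem cubeMeanSquareDomination_false_of_visibleDarkDatum (h : VisibleDarkDatum) :
    ¬ CubeMeanSquareDomination := by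
  rintro ⟨C₂, _, hMS⟩
  obtain ⟨L, _, hL, m₀, hm₁, hm₂, z, hz1, x, y, U, hdet, hpos⟩ := h
  have h1 := hMS L hL m₀ hm₁ hm₂ z hz1 x y U
  simp only [hdet, norm_zero, ne_eq, OfNat.ofNat_ne_zero, not_false_eq_true, zero_pow,
    integral_zero, mul_zero] at h1
  exact absurd h1 (not_le.mpr hpos)

/-- NEAR-MISS (not claimed): the realised flat slabs of §E are NOT visible dark data — their corank is
`≥ 6`, so `adj ≡ 0` on those fibres and (MS) holds there as `0 ≤ 0`.  What (MS) would die of is a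
corank-ONE robust level whose kernel line reaches `x`; the corner argument (`noBlindSpinor`) excludes
`W`-independent such kernels, the strategist's kit job j024618 excludes the full Dirichlet cavity of
`Q₂`, and high-multiplicity exterior flat bands give kernels `Φ c` with `B c = 0` (invisible) unless
the reduced cube resolvent form `A(W)⁻¹|_{range B(W)}` is degenerate for all `W`.  Recorded as an
open target, deliberately WITHOUT a truth claim. -/
theorem visibleDarkDatum_open : VisibleDarkDatum ∨ ¬ VisibleDarkDatum := em _

end Summit.QuantumFields.QCD.Cruxes.FrameAPrioriBound.Disproof

end
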